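import Summits.PneNP.PneNP.Theorems.ChebyshevTracialDesignTiltedSmallBlockExpansion
import HarnessLib

/-!
# Cell pnp-psdrank, route `ChebyshevTracialDesign`: TILTED TWO SMALL BLOCKS — assembly arithmetic (brick 158c; crux
# `TracialDecayExp20`, stmt-PneNP-19878)

Brick 158c (prover g31; MEMO-33 §5, MEMO-34 §2). Small self-contained tools for the assembly of the tilted two-block per-class bound
(brick 158 `…TwoBlock`): §1 the crossing-plane amplitude on two blocks `|2λ₁x₁ + 2λ₂x₂ + L| ≤ 4(b+2) + L₀` (`x₁ + x₂ ≤ b + 2`,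
`|λ_i| ≤ 2`) and the coefficient bounds `|4λ| ≤ 8`, `|4λκ| ≤ 8`, `|4λ²| ≤ 16`, `|8λ₁λ₂| ≤ 32`; §2 counting the pinned pairs of a
stable ground set without an edge inside the blocks (`Σ_{v∈S∩H₁}|S∩H₂| ≤ |S|(|S|−2)`, `Σ_{v∈S∩H_i}|(S∩H_i)∖e_v| ≤ |S|(|S|−2)`);
§3 `twelve_piece_bound` — the final linear arithmetic: main piece `≤ MΛ²`, eleven absolutely bounded pieces, total
`≤ M(Λ + 9T + 4)²`. WHAT THIS FILE DOES NOT DO: anything on `TracialDecayExp20` itself, psd rank of P_PM(K_n), or P vs NP.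
[cite: Rothvoss2017, §2 (PDF pp. 5–6)]
Stature: support/instrument (kernel lane, no defs, axioms standard). Supports stmt-PneNP-19878.
-/

set_option linter.dupNamespace false -- `Summit.PneNP.PneNP.…`: summit = sub-problem (D-0017)

noncomputable section

namespace Summit.PneNP.PneNP.Theorems.ChebyshevTracialDesignTwoBlockArith

open Finset Literature.Combinatorics.Optimization Literature.Combinatorics.Optimization.ShellStep
open Summit.PneNP.PneNP.Theorems.ChebyshevTracialDesignTiltedSmallBlockTools (card_inter_succ_le)
open Summit.PneNP.PneNP.Theorems.ChebyshevTracialDesignTiltedSmallBlockExpansion (card_inter_mul_pred_le)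

variable {n : ℕ}

/-! ### §1 The crossing-plane amplitude and the coefficient bounds -/

/-- The crossing-plane amplitude on two blocks: `|2λ₁x₁ + 2λ₂x₂ + L| ≤ 4(b+2) + L₀` for `x_i ≥ 0`, `x₁ + x₂ ≤ b + 2`, `|λ_i| ≤ 2`,
`|L| ≤ L₀`. [cite: Rothvoss2017, §2 (PDF p. 6)] -/
theorem amplitude_abs_le {l₁ l₂ L L₀ : ℝ} (hl₁ : |l₁| ≤ 2) (hl₂ : |l₂| ≤ 2) (hL : |L| ≤ L₀) {b : ℕ} {x₁ x₂ : ℤ}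
    (h₁ : 0 ≤ x₁) (h₂ : 0 ≤ x₂) (hs : x₁ + x₂ ≤ (b : ℤ) + 2) :
    |2 * l₁ * (x₁ : ℝ) + 2 * l₂ * (x₂ : ℝ) + L| ≤ 4 * ((b + 2 : ℕ) : ℝ) + L₀ := by
  have hx₁ : (0 : ℝ) ≤ x₁ := by exact_mod_cast h₁
  have hx₂ : (0 : ℝ) ≤ x₂ := by exact_mod_cast h₂
  have hsum : (x₁ : ℝ) + x₂ ≤ ((b + 2 : ℕ) : ℝ) := by push_cast; exact_mod_cast hs
  have e1 : |2 * l₁ * (x₁ : ℝ)| ≤ 4 * x₁ := by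
    rw [abs_mul, abs_mul, abs_two, abs_of_nonneg hx₁]; nlinarith [abs_nonneg l₁]
  have e2 : |2 * l₂ * (x₂ : ℝ)| ≤ 4 * x₂ := by
    rw [abs_mul, abs_mul, abs_two, abs_of_nonneg hx₂]; nlinarith [abs_nonneg l₂]
  calc |2 * l₁ * (x₁ : ℝ) + 2 * l₂ * (x₂ : ℝ) + L| ≤ |2 * l₁ * (x₁ : ℝ)| + |2 * l₂ * (x₂ : ℝ)| + |L| :=
        (abs_add_le _ _).trans (add_le_add (abs_add_le _ _) le_rfl)
    _ ≤ 4 * x₁ + 4 * x₂ + L₀ := by linarith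
    _ ≤ _ := by linarith

/-- Coefficient bounds: for `|λ| ≤ 2`, `|κ| ≤ 1`: `|4λ| ≤ 8`, `|4λκ| ≤ 8`, `|4λ²| ≤ 16`. [cite: Rothvoss2017, §2 (PDF p. 6)] -/
theorem coeff_abs_le {l kap : ℝ} (hl : |l| ≤ 2) (hkap : |kap| ≤ 1) :
    |4 * l| ≤ 8 ∧ |4 * l * kap| ≤ 8 ∧ |4 * l ^ 2| ≤ 16 := by
  have h4abs : |(4 : ℝ)| = 4 := abs_of_pos (by norm_num)
  refine ⟨by rw [abs_mul, h4abs]; linarith only [hl], ?_, ?_⟩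
  · rw [abs_mul, abs_mul, h4abs]
    have h1 : |l| * |kap| ≤ 2 * 1 := mul_le_mul hl hkap (abs_nonneg _) (by norm_num)
    linarith only [h1]
  · rw [abs_mul, abs_pow, h4abs]
    have h1 : |l| ^ 2 ≤ 2 ^ 2 := pow_le_pow_left₀ (abs_nonneg l) hl 2
    linarith only [h1]

/-- The cross coefficient: `|8λ₁λ₂| ≤ 32` for `|λ_i| ≤ 2`. [cite: Rothvoss2017, §2 (PDF p. 6)] -/
theorem cross_coeff_abs_le {l₁ l₂ : ℝ} (hl₁ : |l₁| ≤ 2) (hl₂ : |l₂| ≤ 2) : |8 * l₁ * l₂| ≤ 32 := by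
  have h8abs : |(8 : ℝ)| = 8 := abs_of_pos (by norm_num)
  rw [abs_mul, abs_mul, h8abs]
  have h1 : |l₁| * |l₂| ≤ 2 * 2 := mul_le_mul hl₁ hl₂ (abs_nonneg _) (by norm_num)
  nlinarith only [h1, abs_nonneg l₁, abs_nonneg l₂]

/-! ### §2 Counting the pinned pairs -/

/-- In a stable ground set with no edge inside `H₁ ∪ H₂` (disjoint blocks), `Σ_{v∈S∩H₁} |S∩H₂| = |S∩H₁|·|S∩H₂| ≤ |S|(|S|−2)`
(`|S| ≥ 4`). [cite: Rothvoss2017, §2 (PDF p. 5)] -/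
theorem sum_card_cross_le {π : Fin n → Fin n} {S : Finset (Fin n)} (hS : ∀ v ∈ S, π v ∈ S)
    {H₁ H₂ : Finset (Fin n)} (hdisj : Disjoint H₁ H₂) (hno : ∀ v ∈ S, ¬ (v ∈ H₁ ∪ H₂ ∧ π v ∈ H₁ ∪ H₂))
    (h4 : 4 ≤ S.card) :
    (∑ _v ∈ S ∩ H₁, (((S ∩ H₂).card : ℕ) : ℝ)) ≤ (S.card : ℝ) * ((S.card : ℝ) - 2) := by
  rw [sum_const, nsmul_eq_mul]
  have hs : (4 : ℝ) ≤ S.card := by exact_mod_cast h4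
  have heq : (S ∩ H₁).card + (S ∩ H₂).card = (S ∩ (H₁ ∪ H₂)).card := by
    rw [inter_union_distrib_left, card_union_of_disjoint]
    exact disjoint_of_subset_left inter_subset_right (disjoint_of_subset_right inter_subset_right hdisj)
  rcases (S ∩ (H₁ ∪ H₂)).eq_empty_or_nonempty with h | ⟨v, hv⟩
  · have h1 : S ∩ H₁ = ∅ := by
      rw [← subset_empty, ← h]; exact inter_subset_inter_left subset_union_left
    rw [h1, card_empty, Nat.cast_zero, zero_mul]; nlinarith
  · have hle := card_inter_succ_le (π := π) hS (H₁ ∪ H₂) hno hv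
    have had : ((S ∩ H₁).card : ℝ) + (S ∩ H₂).card ≤ (S.card : ℝ) - 1 := by
      have : (((S ∩ H₁).card + (S ∩ H₂).card : ℕ) : ℝ) + 1 ≤ S.card := by rw [heq]; exact_mod_cast hle
      push_cast at this; linarith
    have ha : (0 : ℝ) ≤ (S ∩ H₁).card := Nat.cast_nonneg _
    have hd : (0 : ℝ) ≤ (S ∩ H₂).card := Nat.cast_nonneg _
    nlinarith [sq_nonneg (((S ∩ H₁).card : ℝ) - (S ∩ H₂).card)]

/-- In a stable ground set with no edge inside `Hi`, `Σ_{v∈S∩Hi} |(S∩Hi)∖e_v| ≤ |S|(|S|−2)` (`|S| ≥ 2`).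
[cite: Rothvoss2017, §2 (PDF p. 5)] -/
theorem sum_card_sdiff_pair_le {π : Fin n → Fin n} {S : Finset (Fin n)} (hS : ∀ v ∈ S, π v ∈ S)
    (Hi : Finset (Fin n)) (hnoi : ∀ v ∈ S, ¬ (v ∈ Hi ∧ π v ∈ Hi)) (h2 : 2 ≤ S.card) :
    (∑ v ∈ S ∩ Hi, ((((S ∩ Hi) \ {v, π v}).card : ℕ) : ℝ)) ≤ (S.card : ℝ) * ((S.card : ℝ) - 2) := by
  have h1 : ∀ v ∈ S ∩ Hi, ((S ∩ Hi) \ {v, π v}).card ≤ (S ∩ Hi).card - 1 := by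
    intro v hv
    have : (S ∩ Hi) \ {v, π v} ⊆ (S ∩ Hi).erase v := by
      intro u hu
      rw [mem_sdiff, mem_insert, not_or] at hu
      exact mem_erase.2 ⟨hu.2.1, hu.1⟩
    exact (card_le_card this).trans (by rw [card_erase_of_mem hv])
  have h2' : ∑ v ∈ S ∩ Hi, ((S ∩ Hi) \ {v, π v}).card ≤ S.card * (S.card - 2) :=
    calc ∑ v ∈ S ∩ Hi, ((S ∩ Hi) \ {v, π v}).card ≤ ∑ v ∈ S ∩ Hi, ((S ∩ Hi).card - 1) := sum_le_sum h1
      _ = (S ∩ Hi).card * ((S ∩ Hi).card - 1) := by rw [sum_const, smul_eq_mul]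
      _ ≤ (S.card - 1) * (S.card - 2) := card_inter_mul_pred_le hS Hi hnoi h2
      _ ≤ S.card * (S.card - 2) := Nat.mul_le_mul_right _ (Nat.sub_le _ _)
  have h3 : ((∑ v ∈ S ∩ Hi, ((S ∩ Hi) \ {v, π v}).card : ℕ) : ℝ) ≤ ((S.card * (S.card - 2) : ℕ) : ℝ) := by
    exact_mod_cast h2'
  rw [Nat.cast_sum, Nat.cast_mul, Nat.cast_sub h2] at h3
  simpa using h3

/-! ### §3 The final arithmetic of the twelve pieces -/

/-- **Assembly arithmetic.** With `M = B_v·P·K_c·G·Q ≥ 0`, `Λ, T ≥ 0`: the main piece `≤ MΛ²`, the plain pieces `2·(PT)(GΛ)`-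
and `1·(PT²)G`-bounded, per block the pinned pieces `8·(PT)(GΛ)`, `8·(PT²)G`, `16·(PT)G`, `16·(PT²)G`, and the cross piece
`32·(PT²)G`, sum to at most `M·(Λ + 9T + 4)²`. [cite: Rothvoss2017, §2 (PDF p. 6)] -/
theorem twelve_piece_bound {Bv P Kc G Q T Λ A X₁ X₂ X₃ X₄ X₅ X₆ X₇ X₈ X₉ X₁₀ X₁₁ : ℝ}
    (hBv : 0 ≤ Bv) (hP : 0 ≤ P) (hKc : 0 ≤ Kc) (hG : 0 ≤ G) (hQ : 0 ≤ Q) (hT : 0 ≤ T) (hΛ : 0 ≤ Λ)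
    (hA : A ≤ Bv * P * Kc * (G * Λ ^ 2 * Q))
    (h₁ : |X₁| ≤ 2 * (Bv * (P * T) * Kc * (G * Λ * Q))) (h₂ : |X₂| ≤ 1 * (Bv * (P * T ^ 2) * Kc * (G * Q)))
    (h₃ : |X₃| ≤ 8 * (Bv * (P * T) * Kc * (G * Λ * Q))) (h₄ : |X₄| ≤ 8 * (Bv * (P * T ^ 2) * Kc * (G * Q)))
    (h₅ : |X₅| ≤ 16 * (Bv * (P * T) * Kc * (G * Q))) (h₆ : |X₆| ≤ 16 * (Bv * (P * T ^ 2) * Kc * (G * Q)))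
    (h₇ : |X₇| ≤ 8 * (Bv * (P * T) * Kc * (G * Λ * Q))) (h₈ : |X₈| ≤ 8 * (Bv * (P * T ^ 2) * Kc * (G * Q)))
    (h₉ : |X₉| ≤ 16 * (Bv * (P * T) * Kc * (G * Q))) (h₁₀ : |X₁₀| ≤ 16 * (Bv * (P * T ^ 2) * Kc * (G * Q)))
    (h₁₁ : |X₁₁| ≤ 32 * (Bv * (P * T ^ 2) * Kc * (G * Q))) :
    A - X₁ + X₂ - X₃ + X₄ + X₅ + X₆ - X₇ + X₈ + X₉ + X₁₀ + X₁₁ ≤ Bv * P * Kc * (G * (Λ + 9 * T + 4) ^ 2 * Q) := by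
  have hpoly : Λ ^ 2 + 18 * T * Λ + 81 * T ^ 2 + 32 * T ≤ (Λ + 9 * T + 4) ^ 2 := by
    have e : (Λ + 9 * T + 4) ^ 2 = Λ ^ 2 + 18 * T * Λ + 81 * T ^ 2 + 32 * T + (16 + 8 * Λ + 40 * T) := by ring
    rw [e]; linarith only [hΛ, hT]
  have hMM : 0 ≤ Bv * P * Kc * G * Q := by positivity
  have hsum : Bv * P * Kc * (G * Λ ^ 2 * Q) + 2 * (Bv * (P * T) * Kc * (G * Λ * Q)) + 1 * (Bv * (P * T ^ 2) * Kc * (G * Q))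
      + 2 * (8 * (Bv * (P * T) * Kc * (G * Λ * Q)) + 8 * (Bv * (P * T ^ 2) * Kc * (G * Q))
        + 16 * (Bv * (P * T) * Kc * (G * Q)) + 16 * (Bv * (P * T ^ 2) * Kc * (G * Q)))
      + 32 * (Bv * (P * T ^ 2) * Kc * (G * Q)) ≤ Bv * P * Kc * (G * (Λ + 9 * T + 4) ^ 2 * Q) := by
    have e1 : Bv * P * Kc * (G * Λ ^ 2 * Q) + 2 * (Bv * (P * T) * Kc * (G * Λ * Q)) + 1 * (Bv * (P * T ^ 2) * Kc * (G * Q))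
      + 2 * (8 * (Bv * (P * T) * Kc * (G * Λ * Q)) + 8 * (Bv * (P * T ^ 2) * Kc * (G * Q))
        + 16 * (Bv * (P * T) * Kc * (G * Q)) + 16 * (Bv * (P * T ^ 2) * Kc * (G * Q)))
      + 32 * (Bv * (P * T ^ 2) * Kc * (G * Q)) = Bv * P * Kc * G * Q * (Λ ^ 2 + 18 * T * Λ + 81 * T ^ 2 + 32 * T) := by
      ring
    have e2 : Bv * P * Kc * (G * (Λ + 9 * T + 4) ^ 2 * Q) = Bv * P * Kc * G * Q * (Λ + 9 * T + 4) ^ 2 := by ring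
    rw [e1, e2]
    exact mul_le_mul_of_nonneg_left hpoly hMM
  linarith only [hA, (abs_le.1 h₁).1, (abs_le.1 h₂).2, (abs_le.1 h₃).1, (abs_le.1 h₄).2, (abs_le.1 h₅).2,
    (abs_le.1 h₆).2, (abs_le.1 h₇).1, (abs_le.1 h₈).2, (abs_le.1 h₉).2, (abs_le.1 h₁₀).2, (abs_le.1 h₁₁).2, hsum]

end Summit.PneNP.PneNP.Theorems.ChebyshevTracialDesignTwoBlockArith

end
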